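import Summits.CriticalPhenomena.SAWScalingLimit.Theses.SAWDefectDecoherence

/-!
# Sketch (crux-ideate, stmt-CriticalPhenomena-14004 `BoundaryClosureR`, round 1, ideator 2)

Typed first lemmas of the two idea cards of this seat:

* card `pick-half-plane` — `BoundarySineLaw` (exact, provable now: the normal component of a
  boundary increment of the 3/8-developing map is a positive mass times `sin((3/8)(W_e - W_b))`)
  and `HalfPlaneImage` (the load-bearing conjecture "Claim D": for convex carriers the
  3/8-developing map `H_δ` of the critical SAW parafermion takes values in the closed half-plane
  `{Im (conj κ · (H - H_b)) ≥ 0}`, up to `o(|F_δ(b_δ)|/δ)`, on compacts);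
* card `birkhoff-crosscut-contraction` — `FlatBoundaryRatioMixing` (two-root boundary Harnack
  principle for the spin-0 arrival masses with a polynomial rate, flat-ball case).

Nothing here is proved; the file only has to elaborate (`lean check` rc 0, no sorries: all three
are `def … : Prop`).
-/

noncomputable section

open scoped BigOperators ComplexConjugate Topology
open Filter Set MeasureTheory
open Literature.Probability.LatticeModels Literature.Probability.RandomPlanarGeometry
open Literature.Probability.RandomPlanarGeometry.SAW
open Summit.CriticalPhenomena.SAWScalingLimit.Theses.SAWDefectDecoherence

namespace Summit.CriticalPhenomena.SAWScalingLimit.Cruxes.BoundaryClosureR.Ideator2Sketch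

/-- **Boundary sine law** (exact; corollary of winding rigidity, support item 8515, and of the cup
card's `BoundaryIncrementPhase`).  Root `a = {u,w}` (`u ∉ Λ ∋ w`), normaliser `b ∈ ∂Ω`,
`κ := (c_w - c_u)·e^{i(3/8)W_b}`.  For every other boundary mid-edge `e = {u',w'}` the increment
`ι(e) = (mid e - c_{w'})·F_{5/8}(e)` of the boundary polygon of the developing map satisfies
`Im(conj κ · ι(e)) = |c_w - c_u|·|mid e - c_{w'}|·Z(e)·sin((3/8)(W_e - W_b))`:
the SIGN of the normal component of every boundary increment is the sign of
`sin((3/8)(W_e - W_b))` — the lattice trace of the half-plane property. -/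
def BoundarySineLaw : Prop :=
  ∀ (Λ : Finset HexVertex), hexDomainSimplyConnected Λ →
  ∀ (u w : HexVertex), hexGraph.Adj u w → u ∉ Λ → w ∈ Λ →
  ∀ b ∈ hexDomainBoundary Λ, ∀ γb : HexMidEdgeSAW Λ s(u, w) b,
  ∀ (u' w' : HexVertex), hexGraph.Adj u' w' → u' ∉ Λ → w' ∈ Λ →
  ∀ γe : HexMidEdgeSAW Λ s(u, w) s(u', w'),
    ((starRingEnd ℂ) ((hexCenter w - hexCenter u) *
          Complex.exp (Complex.I * (3 / 8 : ℂ) * (γb.winding : ℂ))) *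
        ((hexMidpoint s(u', w') - hexCenter w') *
          hexParafermionicObservable Λ s(u, w) hexCriticalFugacity (5 / 8) s(u', w'))).im =
      ‖hexCenter w - hexCenter u‖ * ‖hexMidpoint s(u', w') - hexCenter w'‖ *
        ‖hexParafermionicObservable Λ s(u, w) hexCriticalFugacity 0 s(u', w')‖ *
        Real.sin ((3 / 8 : ℝ) * (γe.winding - γb.winding))

/-- **Claim D — the half-plane image of the 3/8-developing map** (load-bearing conjecture of card
`pick-half-plane`), in the setting of the repaired target `HexObservableLimitR` restricted to CONVEX
carriers: for every admissible family, every `ε > 0` and every compact `K ⊆ Ω`, eventually in `δ`,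
every potential `H` of `F_δ dz` on the triangular sites (the increment relation is that of the pool
item `PotentialExists`, stmt-8299) satisfies
`δ · Im( conj κ_δ · (H s - H s_b) ) ≥ -ε |F_δ(b_δ)|`
for every site `s` over `K`, where `κ_δ := (c_w - c_u)·e^{i(3/8) W(a_δ → b_δ)}` (rigid winding) and
`s_b` is a site on the dual edge of `b_δ`.  In `h`-units (`h = δ H / F_δ(b_δ)`) this says
`Im(conj κ̂ · h_δ) ≥ -o(1)` on compacts: the normalised developing maps take values in a half-plane
whose boundary line contains the image of the flat normalising piece — so their subsequential
limits composed with the Riemann map are Pick (Nevanlinna–Herglotz) functions. -/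
def HalfPlaneImage : Prop :=
  ∀ (D : DobrushinDomain) (ρ : ℝ) (Λ : ℝ → Finset HexVertex) (m : Fin 2 → ℝ → ℤ)
    (a b : ℝ → Sym2 HexVertex),
    Convex ℝ D.carrier → 0 < ρ →
    (∀ i : Fin 2, D.carrier ∩ Metric.ball (D.pt i) ρ =
        {z : ℂ | (D.pt i).im < z.im} ∩ Metric.ball (D.pt i) ρ) →
    (∀ᶠ δ : ℝ in 𝓝[>] 0, hexDomainSimplyConnected (Λ δ) ∧ a δ ∈ hexDomainBoundary (Λ δ) ∧
        b δ ∈ hexDomainBoundary (Λ δ) ∧ Nonempty (HexMidEdgeSAW (Λ δ) (a δ) (b δ)) ∧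
        (hexGraph.induce ((Λ δ : Finset HexVertex) : Set HexVertex)).Preconnected ∧
        (∀ v ∈ Λ δ, (δ : ℂ) * hexCenter v ∈ D.carrier) ∧
        (∀ i : Fin 2, ∀ v : HexVertex, (δ : ℂ) * hexCenter v ∈ Metric.ball (D.pt i) ρ →
          (v ∈ Λ δ ↔ m i δ ≤ v.1 1))) →
    (∀ K : Set ℂ, IsCompact K → K ⊆ D.carrier →
        ∀ᶠ δ : ℝ in 𝓝[>] 0, ∀ v : HexVertex, (δ : ℂ) * hexCenter v ∈ K → v ∈ Λ δ) →
    Tendsto (fun δ : ℝ => (δ : ℂ) * hexMidpoint (a δ)) (𝓝[>] 0) (𝓝 (D.pt 0)) →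
    Tendsto (fun δ : ℝ => (δ : ℂ) * hexMidpoint (b δ)) (𝓝[>] 0) (𝓝 (D.pt 1)) →
    ∀ ε : ℝ, 0 < ε → ∀ K : Set ℂ, IsCompact K → K ⊆ D.carrier →
    ∀ᶠ δ : ℝ in 𝓝[>] 0,
      ∀ H : Site 2 → ℂ,
        (∀ v ∈ Λ δ, ∀ w : HexVertex, hexGraph.Adj v w → ∀ s t : Site 2,
            s ∈ hexFaceVertices v → t ∈ hexFaceVertices v → s ∈ hexFaceVertices w →
            t ∈ hexFaceVertices w → s ≠ t →
            0 < ((starRingEnd ℂ) (triEmbed t - triEmbed s) * (hexCenter v - triEmbed s)).im →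
            H t - H s = (hexMidpoint s(v, w) - hexCenter v) *
              hexParafermionicObservable (Λ δ) (a δ) hexCriticalFugacity (5 / 8) s(v, w)) →
      ∀ (u w : HexVertex), a δ = s(u, w) → u ∉ Λ δ → w ∈ Λ δ →
      ∀ γ : HexMidEdgeSAW (Λ δ) (a δ) (b δ),
      ∀ (ub wb : HexVertex), b δ = s(ub, wb) →
      ∀ sb : Site 2, sb ∈ hexFaceVertices ub → sb ∈ hexFaceVertices wb →
      ∀ v ∈ Λ δ, ∀ s ∈ hexFaceVertices v, (δ : ℂ) * triEmbed s ∈ K →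
        -ε * ‖hexParafermionicObservable (Λ δ) (a δ) hexCriticalFugacity (5 / 8) (b δ)‖ ≤
          δ * ((starRingEnd ℂ) ((hexCenter w - hexCenter u) *
                  Complex.exp (Complex.I * (3 / 8 : ℂ) * (γ.winding : ℂ))) * (H s - H sb)).im

/-- **Flat-ball two-root boundary Harnack principle with a rate** (first checkable statement of card
`birkhoff-crosscut-contraction`; lattice units, spin `0` arrival masses `Z_x(z) = F_{x_c,0}(x,z)`):
there are `C` and `c > 0` such that for every simply connected `Λ`, two boundary roots `a, a'`,
and a ball `B(p, R)` in which `Λ` is the exact half-lattice `{row ≥ n}` and which stays at distance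
`≥ R` from both roots, any two boundary targets `e, e'` within distance `r ≤ R` of `p` have
`|Z_a(e) Z_{a'}(e') - Z_a(e') Z_{a'}(e)| ≤ C (r/R)^c (Z_a(e) Z_{a'}(e') + Z_a(e') Z_{a'}(e))`:
the ratio of the arrival masses of the two roots is constant along the flat piece up to a
polynomially small error — the last `log(R/r)` dyadic half-annuli of the (reversed) walks forget
which root they are heading to (Birkhoff–Hopf contraction of single-crossing kernels). -/
def FlatBoundaryRatioMixing : Prop :=
  ∃ C c : ℝ, 0 < c ∧ ∀ (Λ : Finset HexVertex), hexDomainSimplyConnected Λ →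
  ∀ a ∈ hexDomainBoundary Λ, ∀ a' ∈ hexDomainBoundary Λ,
  ∀ (p : ℂ) (n : ℤ) (r R : ℝ), 1 ≤ r → r ≤ R →
    (∀ v : HexVertex, hexCenter v ∈ Metric.ball p R → (v ∈ Λ ↔ n ≤ v.1 1)) →
    R ≤ dist p (hexMidpoint a) → R ≤ dist p (hexMidpoint a') →
  ∀ e ∈ hexDomainBoundary Λ, ∀ e' ∈ hexDomainBoundary Λ,
    hexMidpoint e ∈ Metric.ball p r → hexMidpoint e' ∈ Metric.ball p r →
    |‖hexParafermionicObservable Λ a hexCriticalFugacity 0 e‖ *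
          ‖hexParafermionicObservable Λ a' hexCriticalFugacity 0 e'‖ -
        ‖hexParafermionicObservable Λ a hexCriticalFugacity 0 e'‖ *
          ‖hexParafermionicObservable Λ a' hexCriticalFugacity 0 e‖| ≤
      C * (r / R) ^ c *
        (‖hexParafermionicObservable Λ a hexCriticalFugacity 0 e‖ *
            ‖hexParafermionicObservable Λ a' hexCriticalFugacity 0 e'‖ +
          ‖hexParafermionicObservable Λ a hexCriticalFugacity 0 e'‖ *
            ‖hexParafermionicObservable Λ a' hexCriticalFugacity 0 e‖)

end Summit.CriticalPhenomena.SAWScalingLimit.Cruxes.BoundaryClosureR.Ideator2Sketch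

end
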